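import Summits.HodgeConjecture.HodgeConjecture.Theorems.F0P3cStCharTSWeylCartanRadial     -- ★ p851692 «ELL-TOR★» (this seat): `isClosed_cartan`, `mul_comm_cartan`, `centralizer_eq_cartan_of_isRegularElt`, `index_cartan_…`, `image_conjFamily_regular_eq`, `measurableSet_cartanSet`, `isRegularElt_conj_val_iff`, `measurableSet_setOf_isRegularElt`
import Summits.HodgeConjecture.HodgeConjecture.Theorems.F0P3cStCharTSWeylCartanFibre      -- ★-cand p851702 (E1a) (this seat): `subsingleton_preimage_inter_prod`, `exists_isOpen_wFree_nhds`, `wFree_mono`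
import Summits.HodgeConjecture.HodgeConjecture.Theorems.F0P3cStCharTSWeylHypJacobian       -- ★ p849811 (LH2-p02 (g3)): §1 `restrict_eq_restrict_of_forall_nhds` (generic)
import HarnessLib

/-!
# F0 · P3c · line LH6 «StCharTS» — «ELL-TOR★» (E1b) «JAC-CARTAN BY SHAPE»: THE LOCAL TUBE JACOBIAN AT AN ARBITRARY CARTAN SUBGROUP `T = Z(γ₀)` OF `U(Φ₃)(L⁺_v)`
# ⇒ THE WEIGHTED WEYL INTEGRATION FORMULA ON THE `T`-REGULAR SET (Harish-Chandra 1970 Lemmas 20, 22, 42; Rogawski 1990 §12.5 p. 182)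

Cell `pub/hodgecm-mathlib`, crux H413 = `stmt-HodgeConjecture-24833` (lane `--supports`, helper); seat F0P3a-p05 (g22); road «ELL-TOR★» (NAMING 2026-09-02T14:19:42Z, «=» LH6-p03
(g5) 14:22:45Z), the transposition of ★ p851645 `…WeylHypJacobianLocal` (LH6-p03 (g5)) from the split torus `M` to ANY Cartan `T = Z(γ₀)`.  THEOREMS ONLY; sorry-free; no
definition ∕ instance ∕ notation ∕ named fact; ★-only imports; axioms TRIO.

WHY.  ★ p851692 gives, for every Cartan `T = Z(γ₀)` (`γ₀` regular, `v` non-split), the radial Weyl formula on the `T`-regular set `G_T = ⋃ₓ x T^{reg} x⁻¹` with an UNSPECIFIED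
radial measure `σ_T`; the classical content of the Weyl integration formula [Rogawski1990 §12.5 p. 182] is `dσ_T = |D_G(t)| dtm(t)` — the Jacobian of the conjugation map
[HarishChandra1970 L. 20 ∕ L. 22].  For the split torus the (TOR) road banked this as «radial = `D · tm` ⟸ the LOCAL tube Jacobian» (★ p849811 global, ★ p851645 local socket
`hJacLoc`), the socket the JAC-LOC road (LH6-p03 (g5), (J0)–(J7)) is paying in house.  This file gives the ELLIPTIC half (and every Cartan uniformly) the SAME socket shape,
so that a local Jacobian computation at a compact Cartan — whenever it is done — closes the elliptic half of WIF with no further measure theory: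

* **`lintegral_cartanSet_eq_of_tubeJacobian_local`** — under `hJacLoc_T : ∀ t₀ ∈ T^{reg}, ∃ U ∋ t₀ open in T, ∃ A₀ ⊆ G⧸T` (measurable, `0 < μ₀ A₀ < ∞`), `∀ V ⊆ U` measurable,
  regular and `W`-FREE (`∀ n ∉ T`, no two points of `V` are `n`-conjugate — the inline clause of ★ (E1a), replacing ★ p851645's `t′ ≠ w t w⁻¹`),
  `ν(Φ(A₀ × V)) = μ₀(A₀) · ∫⁻_V D dtm`: for every Borel `f ≥ 0`, **`[N(T):T] · ∫⁻_{G_T} f dν = ∫⁻_{t ∈ T^{reg}} D(t) · ∫⁻_{G⧸T} f(Φ(q,t)) dμ₀ dtm`**.  Proof = ★ p851645's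
  verbatim: fibre-count pull-back `μ` of `ν` (★ `exists_measure_apply_eq_lintegral_count_fibre`), Weil factorisation `μ = μ₀ ⊗ σ` (★ `exists_radial_prod_eq_fibreCount_conjFamily`,
  «regular set» `R = {regular}` as in ★ p851692), on a `W`-free `V` every fibre of `Φ` meets `A₀ × V` at most once (★ (E1a) `subsingleton_preimage_inter_prod`) so
  `μ₀(A₀) σ(V) = ν(Φ(A₀ × V))`, evaluated inside `U(t₀) ∩` a `W`-free neighbourhood of `t₀` (★ (E1a) `exists_isOpen_wFree_nhds`, finite Weyl group ★ WEYL-FIN) with the local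
  `A₀(t₀)`, then ★ p849811 §1 `restrict_eq_restrict_of_forall_nhds`.
* **`integral_cartanSet_eq_of_tubeJacobian_local`** — the ℂ-valued Bochner form `∫_{t ∈ T^{reg}} D(t) • (∫_{G⧸T} g(Φ(q, t)) dμ₀) dtm = [N(T):T] • ∫_{G_T} g dν` for `g`
  `ν`-integrable on `G_T` (★ p849733 §2 transport, as ★ p851645).

HONEST LABEL: count-neutral; CONDITIONAL on `hJacLoc_T` (by shape, the true statement of `p`-adic analysis at `D = |D_G|`, not proved here); closes no organ.  HC_CM is proved
only modulo the 7 printed citations (2 remaining: hLiu418 = `stmt-HodgeConjecture-24832`, h413 = `stmt-HodgeConjecture-24833`) until rung 0 closes.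

## References
* [Rogawski1990] J. D. Rogawski, *Automorphic Representations of Unitary Groups in Three Variables*, Ann. of Math. Stud. 123 (1990), §12.5 p. 182.
* [HarishChandra1970] Harish-Chandra (notes by G. van Dijk), *Harmonic analysis on reductive p-adic groups*, LNM 162 (1970), Part V §3 Lemma 20 (the conjugation map
  `(x, γ) ↦ γˣ` onto `G_Γ` is submersive), §4 Lemma 22 (the Jacobian `|det(Ad(γ⁻¹) − 1)|`), Lemma 42 (the Weyl integration formula on `G_A`).
* [Weil1965] A. Weil, *Sur la formule de Siegel dans la théorie des groupes classiques*, Acta Math. 113 (1965), n° 49 Lemme 22 (p. 70).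
* [Federer1969] H. Federer, *Geometric Measure Theory* (1969), §2.10.10.
-/

set_option autoImplicit false
-- the mandated namespace has the single-problem summit's repeated segment (`HodgeConjecture.HodgeConjecture`)
set_option linter.dupNamespace false

noncomputable section

open MeasureTheory Measure Set Filter Topology Function NumberField IsDedekindDomain Matrix Polynomial
open Literature.MeasureTheory.Group
open Literature.NumberTheory.Automorphic Literature.NumberTheory.Automorphic.UnitaryGroup Literature.NumberTheory.Rogawski1990
open Summit.HodgeConjecture.HodgeConjecture.Cruxes.H413.F0P3cStCharTSWeylHypMeasure
open Summit.HodgeConjecture.HodgeConjecture.Cruxes.H413.F0P3cStCharTSWeylHypJacobian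
open Summit.HodgeConjecture.HodgeConjecture.Cruxes.H413.F0P3cStCharTSWeylCartanRadial
open Summit.HodgeConjecture.HodgeConjecture.Cruxes.H413.F0P3cStCharTSWeylCartanFibre
open scoped ENNReal NNReal MatrixGroups Pointwise

namespace Summit.HodgeConjecture.HodgeConjecture.Cruxes.H413.F0P3cStCharTSWeylCartanJacobian

section CM

variable {L : Type} [Field L] [NumberField L] [IsCMField L] {v : HeightOneSpectrum (𝓞 ↥(maximalRealSubfield L))}
  {T : Subgroup (Gqs L v)} {γ₀ : Gqs L v} (hγ₀ : IsRegularElt (γ₀.val : GL (Fin 3) (LocalRing L v)))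
  (hT : T = Subgroup.centralizer ({γ₀} : Set (Gqs L v)))
  (Φ : (Gqs L v ⧸ T) × ↥T → Gqs L v) (hΦ : ∀ (x : Gqs L v) (t : ↥T), Φ (QuotientGroup.mk x, t) = x * t * x⁻¹)
  (hns : ∀ w : PlacesOver L v, IsCMField.complexConj L • w.1 = w.1)
  [MeasurableSpace (Gqs L v)] [BorelSpace (Gqs L v)] [LocallyCompactSpace (Gqs L v)] [SecondCountableTopology (Gqs L v)] [T2Space (Gqs L v)]
  [MeasurableSpace (Gqs L v ⧸ T)] [BorelSpace (Gqs L v ⧸ T)]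
  (ν : Measure (Gqs L v)) [ν.IsHaarMeasure] [ν.IsMulRightInvariant]
  (tm : Measure ↥T) [tm.IsMulLeftInvariant] [IsFiniteMeasureOnCompacts tm] [tm.IsOpenPosMeasure] [tm.IsInvInvariant]
  (D : ↥T → ℝ≥0) (hD : Measurable D)

/-! ## §1 Local tube Jacobian at `T = Z(γ₀)` ⇒ radial measure `= D · tm` on `T^{reg}` -/

set_option maxHeartbeats 1600000 in
set_option synthInstance.maxHeartbeats 200000 in
-- instance-term unification on the CM local carrier (`quotientMeasure` with its σ-algebra arguments), as in ★ p849811 ∕ ★ p851645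
include hγ₀ hΦ hns hD in
/-- **LOCAL TUBE JACOBIAN AT A CARTAN `T = Z(γ₀)` ⇒ WEIGHTED WEYL INTEGRATION FORMULA ON THE `T`-REGULAR SET OF `U(Φ₃)(L⁺_v)`** (`v` non-split, `γ₀` regular; `G = Gqs L v`,
`ν`, `tm`, `Φ`, `G_T = {g t g⁻¹ | t ∈ T regular}`, `μ₀ = ν∕tm` as in ★ p851692 `exists_radialMeasure_lintegral_cartanSet`; `D : T → ℝ≥0` any measurable weight).  IF every regular
`t₀ ∈ T` has an open neighbourhood `U ∋ t₀` in `T` and SOME measurable `A₀ ⊆ G ⧸ T` with `0 < μ₀(A₀) < ∞` such that for every measurable, regular, `W`-FREE `V ⊆ U`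
(`∀ n ∉ T, ∀ t t′ ∈ V, t′ ≠ n t n⁻¹`) the tube `Φ(A₀ × V)` has Haar measure `μ₀(A₀) · ∫⁻_V D dtm` (hypothesis `hJacLoc`, the Jacobian of conjugation READ LOCALLY at `T`,
[HarishChandra1970, L. 20, L. 22]), THEN for every Borel `f ≥ 0`  **`[N(T):T] · ∫⁻_{G_T} f dν = ∫⁻_{t ∈ T^{reg}} D(t) · ∫⁻_{G⧸T} f(Φ(q, t)) dμ₀(q) dtm(t)`**.  At `T = M` this is ★ p851645
(`[N(M):M] = 2`, its `w`-clause implied by the `W`-free clause); at `T` compact it is the ELLIPTIC half of the Weyl integration formula modulo its Jacobian.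
[cite: Rogawski1990, §12.5 p. 182] [cite: HarishChandra1970, Lemma 20; Lemma 22; Lemma 42] [cite: Weil1965, n° 49 Lemme 22 (p. 70)] [cite: Federer1969, §2.10.10] -/
theorem lintegral_cartanSet_eq_of_tubeJacobian_local
    (hJacLoc : ∀ t₀ : ↥T, IsRegularElt (((t₀ : Gqs L v)).val : GL (Fin 3) (LocalRing L v)) →
      ∃ U : Set ↥T, IsOpen U ∧ t₀ ∈ U ∧
        ∃ A₀ : Set (Gqs L v ⧸ T), MeasurableSet A₀ ∧ (quotientMeasure T tm (isClosed_cartan hT) ν) A₀ ≠ 0 ∧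
          (quotientMeasure T tm (isClosed_cartan hT) ν) A₀ ≠ ∞ ∧
          ∀ V : Set ↥T, MeasurableSet V → V ⊆ U → (∀ t ∈ V, IsRegularElt (((t : Gqs L v)).val : GL (Fin 3) (LocalRing L v))) →
            (∀ n : Gqs L v, n ∉ T → ∀ t ∈ V, ∀ t' ∈ V, ((t' : ↥T) : Gqs L v) ≠ n * t * n⁻¹) →
              ν (Φ '' (A₀ ×ˢ V)) = (quotientMeasure T tm (isClosed_cartan hT) ν) A₀ * ∫⁻ t in V, (D t : ℝ≥0∞) ∂tm) :
    ∀ f : Gqs L v → ℝ≥0∞, Measurable f →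
      ((T.subgroupOf (Subgroup.normalizer (T : Set (Gqs L v)))).index : ℝ≥0∞) *
          ∫⁻ y in {x | ∃ g t : Gqs L v, t ∈ T ∧ IsRegularElt (t.val : GL (Fin 3) (LocalRing L v)) ∧ g * t * g⁻¹ = x}, f y ∂ν =
        ∫⁻ t in {t : ↥T | IsRegularElt (((t : Gqs L v)).val : GL (Fin 3) (LocalRing L v))},
          (D t : ℝ≥0∞) * ∫⁻ q, f (Φ (q, t)) ∂(quotientMeasure T tm (isClosed_cartan hT) ν) ∂tm := by
  classical
  -- §a the Cartan data (★ p851692 §1–§2): `T` closed abelian, `[N(T):T] ≠ 0`, centralisers of regular elements of `T`, regular locus Borel and conjugation-invariant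
  have hTcl := isClosed_cartan hT
  haveI := hTcl
  have hTa : ∀ a ∈ T, ∀ b ∈ T, a * b = b * a := mul_comm_cartan hγ₀ hT
  have hW0 := index_cartan_subgroupOf_normalizer_ne_zero hγ₀ hT hns
  have hRm : MeasurableSet {g : Gqs L v | IsRegularElt (g.val : GL (Fin 3) (LocalRing L v))} := measurableSet_setOf_isRegularElt L v hns
  have hRT : ∀ t : ↥T, (t : Gqs L v) ∈ {x : Gqs L v | IsRegularElt (x.val : GL (Fin 3) (LocalRing L v))} →
      Subgroup.centralizer ({(t : Gqs L v)} : Set (Gqs L v)) = T := fun t ht => centralizer_eq_cartan_of_isRegularElt hγ₀ hT t ht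
  have hRc : ∀ g x : Gqs L v, x ∈ {x : Gqs L v | IsRegularElt (x.val : GL (Fin 3) (LocalRing L v))} →
      g * x * g⁻¹ ∈ {x : Gqs L v | IsRegularElt (x.val : GL (Fin 3) (LocalRing L v))} := fun g x hx => (isRegularElt_conj_val_iff L v g x).2 hx
  -- §b topology ∕ measurability: Polish product, `Φ` continuous, `T^{reg}` open in `T`, the regular part `D₀` of `G⧸T × T` Borel, `G_T = Φ(D₀)` Borel
  haveI : PolishSpace ((Gqs L v ⧸ T) × ↥T) := polishSpace_quotient_prod_subgroup T hTcl
  have hΦc : Continuous Φ := (continuous_conjFamily_and_smul T Φ hΦ).1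
  haveI : SecondCountableTopology ↥T := TopologicalSpace.Subtype.secondCountableTopology _
  haveI : BorelSpace ((Gqs L v ⧸ T) × ↥T) := Prod.borelSpace
  haveI : T1Space (Gqs L v ⧸ T) := QuotientGroup.instT1Space
  haveI : MeasurableSingletonClass (Gqs L v ⧸ T) := ⟨fun x => isClosed_singleton.measurableSet⟩
  haveI : MeasurableSingletonClass ↥T := ⟨fun x => isClosed_singleton.measurableSet⟩
  haveI : MeasurableSingletonClass ((Gqs L v ⧸ T) × ↥T) := Prod.instMeasurableSingletonClass
  haveI : SecondCountableTopology (Gqs L v ⧸ T) := (QuotientGroup.isQuotientMap_mk _).secondCountableTopology QuotientGroup.isOpenMap_coe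
  haveI : LocallyCompactSpace (Gqs L v ⧸ T) := QuotientGroup.instLocallyCompactSpace _
  haveI : SigmaCompactSpace (Gqs L v ⧸ T) := sigmaCompactSpace_of_locallyCompact_secondCountable
  haveI : SigmaFinite (quotientMeasure T tm hTcl ν) := SigmaFinite.of_isFiniteMeasureOnCompacts _
  obtain ⟨w⟩ := (inferInstance : Nonempty (PlacesOver L v))
  have hSo : IsOpen {t : ↥T | IsRegularElt (((t : Gqs L v)).val : GL (Fin 3) (LocalRing L v))} :=
    (isOpen_setOf_isRegularElt_cmDatum_local (L := L) (H := qsForm L) (v := v) w (hns w)).preimage continuous_subtype_val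
  have hSm := hSo.measurableSet
  have hDm : MeasurableSet {p : (Gqs L v ⧸ T) × ↥T | ((p.2 : ↥T) : Gqs L v) ∈ {x : Gqs L v | IsRegularElt (x.val : GL (Fin 3) (LocalRing L v))}} :=
    hRm.preimage (continuous_subtype_val.measurable.comp measurable_snd)
  have hinj := locallyInjOn_conjFamily T hTcl hTa Φ hΦ {x : Gqs L v | IsRegularElt (x.val : GL (Fin 3) (LocalRing L v))} hRT hW0
  have hΩeq := image_conjFamily_regular_eq Φ hΦ
  have hΩm : MeasurableSet {x | ∃ g t : Gqs L v, t ∈ T ∧ IsRegularElt (t.val : GL (Fin 3) (LocalRing L v)) ∧ g * t * g⁻¹ = x} :=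
    measurableSet_cartanSet hγ₀ hT Φ hΦ hns
  -- §c the fibre-count pull-back `μ` of `ν` and its Weil factorisation `μ = μ₀ ⊗ σ`; the radial formula for this `σ`
  obtain ⟨μ, hμ⟩ := exists_measure_apply_eq_lintegral_count_fibre hDm hΦc hinj ν
  have hwc : ∀ y ∈ Φ '' {p : (Gqs L v ⧸ T) × ↥T | ((p.2 : ↥T) : Gqs L v) ∈ {x : Gqs L v | IsRegularElt (x.val : GL (Fin 3) (LocalRing L v))}},
      Measure.count (Φ ⁻¹' {y} ∩ {p : (Gqs L v ⧸ T) × ↥T | ((p.2 : ↥T) : Gqs L v) ∈ {x : Gqs L v | IsRegularElt (x.val : GL (Fin 3) (LocalRing L v))}}) =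
        ((T.subgroupOf (Subgroup.normalizer (T : Set (Gqs L v)))).index : ℝ≥0∞) :=
    fun y hy => count_fibre_conjFamily_eq T hTa Φ hΦ {x : Gqs L v | IsRegularElt (x.val : GL (Fin 3) (LocalRing L v))} hRT hRc hW0 hy
  obtain ⟨σ, hσfin, hσsf, hσcar, hprod⟩ :=
    exists_radial_prod_eq_fibreCount_conjFamily T hTcl hTa ν Φ hΦ {x : Gqs L v | IsRegularElt (x.val : GL (Fin 3) (LocalRing L v))} hRm hRT hRc hW0 tm hμ
  haveI := hσsf
  have hformula : ∀ f : Gqs L v → ℝ≥0∞, Measurable f →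
      ((T.subgroupOf (Subgroup.normalizer (T : Set (Gqs L v)))).index : ℝ≥0∞) *
          ∫⁻ y in {x | ∃ g t : Gqs L v, t ∈ T ∧ IsRegularElt (t.val : GL (Fin 3) (LocalRing L v)) ∧ g * t * g⁻¹ = x}, f y ∂ν =
        ∫⁻ t, ∫⁻ q, f (Φ (q, t)) ∂(quotientMeasure T tm hTcl ν) ∂σ := by
    intro f hf
    have h1 := lintegral_comp_eq_mul_setLIntegral_image hDm hΦc hinj hμ hwc hf
    rw [hΩeq, ← hprod, lintegral_prod_symm (fun z : (Gqs L v ⧸ T) × ↥T => f (Φ z)) (hf.comp hΦc.measurable).aemeasurable] at h1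
    exact h1.symm
  -- §d evaluation on tubes over `W`-free regular `V`: `σ V = ∫⁻_V D dtm`
  have htube : ∀ A₀ : Set (Gqs L v ⧸ T), MeasurableSet A₀ → (quotientMeasure T tm hTcl ν) A₀ ≠ 0 → (quotientMeasure T tm hTcl ν) A₀ ≠ ∞ →
      ∀ V : Set ↥T, MeasurableSet V → (∀ t ∈ V, IsRegularElt (((t : Gqs L v)).val : GL (Fin 3) (LocalRing L v))) →
      (∀ n : Gqs L v, n ∉ T → ∀ t ∈ V, ∀ t' ∈ V, ((t' : ↥T) : Gqs L v) ≠ n * t * n⁻¹) →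
      ν (Φ '' (A₀ ×ˢ V)) = (quotientMeasure T tm hTcl ν) A₀ * ∫⁻ t in V, (D t : ℝ≥0∞) ∂tm → σ V = ∫⁻ t in V, (D t : ℝ≥0∞) ∂tm := by
    intro A₀ hA₀m hA₀0 hA₀top V hVm hVreg hVfree h3
    have hE : MeasurableSet (A₀ ×ˢ V) := hA₀m.prod hVm
    have hEsub : A₀ ×ˢ V ⊆ {p : (Gqs L v ⧸ T) × ↥T | ((p.2 : ↥T) : Gqs L v) ∈ {x : Gqs L v | IsRegularElt (x.val : GL (Fin 3) (LocalRing L v))}} :=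
      fun p hp => hVreg p.2 hp.2
    have hEim : MeasurableSet (Φ '' (A₀ ×ˢ V)) := by
      rw [← inter_eq_left.2 hEsub]; exact measurableSet_image_inter_of_locallyInjOn hDm hΦc hinj hE
    -- every fibre meets `A₀ × V` at most once (★ (E1a))
    have hsub : ∀ y, (Φ ⁻¹' {y} ∩ (A₀ ×ˢ V ∩ {p : (Gqs L v ⧸ T) × ↥T | ((p.2 : ↥T) : Gqs L v) ∈ {x : Gqs L v | IsRegularElt (x.val : GL (Fin 3) (LocalRing L v))}})).Subsingleton :=
      fun y => (subsingleton_preimage_inter_prod T hTa Φ hΦ hVfree A₀ y).anti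
        (inter_subset_inter_right _ inter_subset_left)
    have hcount : ∀ y, Measure.count (Φ ⁻¹' {y} ∩ (A₀ ×ˢ V ∩ {p : (Gqs L v ⧸ T) × ↥T | ((p.2 : ↥T) : Gqs L v) ∈ {x : Gqs L v | IsRegularElt (x.val : GL (Fin 3) (LocalRing L v))}})) =
        (Φ '' (A₀ ×ˢ V)).indicator 1 y := by
      intro y
      by_cases hy : y ∈ Φ '' (A₀ ×ˢ V)
      · obtain ⟨p, hp, rfl⟩ := hy
        have hmem : p ∈ Φ ⁻¹' {Φ p} ∩ (A₀ ×ˢ V ∩ {p : (Gqs L v ⧸ T) × ↥T | ((p.2 : ↥T) : Gqs L v) ∈ {x : Gqs L v | IsRegularElt (x.val : GL (Fin 3) (LocalRing L v))}}) :=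
          ⟨rfl, hp, hEsub hp⟩
        rw [(hsub (Φ p)).eq_singleton_of_mem hmem, Measure.count_singleton, indicator_of_mem (mem_image_of_mem Φ hp), Pi.one_apply]
      · have hempty : Φ ⁻¹' {y} ∩ (A₀ ×ˢ V ∩ {p : (Gqs L v ⧸ T) × ↥T | ((p.2 : ↥T) : Gqs L v) ∈ {x : Gqs L v | IsRegularElt (x.val : GL (Fin 3) (LocalRing L v))}}) = ∅ :=
          eq_empty_of_forall_notMem fun p hp => hy ⟨p, hp.2.1, hp.1⟩
        rw [hempty, measure_empty, indicator_of_notMem hy]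
    have hμE : μ (A₀ ×ˢ V) = ν (Φ '' (A₀ ×ˢ V)) := by
      rw [hμ _ hE, lintegral_congr fun y => hcount y, lintegral_indicator_one hEim]
    have hμE' : μ (A₀ ×ˢ V) = (quotientMeasure T tm hTcl ν) A₀ * σ V := by
      rw [← hprod, Measure.prod_prod]
    rw [← hμE, hμE'] at h3
    exact (ENNReal.mul_right_inj hA₀0 hA₀top).1 h3
  -- §e every regular `t₀` has a `W`-free open neighbourhood (★ (E1a), finite Weyl group); on it `σ = D · tm`
  have hnbhd : ∀ t₀ ∈ {t : ↥T | IsRegularElt (((t : Gqs L v)).val : GL (Fin 3) (LocalRing L v))}, ∃ U : Set ↥T, IsOpen U ∧ t₀ ∈ U ∧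
      σ.restrict (U ∩ {t : ↥T | IsRegularElt (((t : Gqs L v)).val : GL (Fin 3) (LocalRing L v))}) =
        (tm.withDensity fun t => (D t : ℝ≥0∞)).restrict (U ∩ {t : ↥T | IsRegularElt (((t : Gqs L v)).val : GL (Fin 3) (LocalRing L v))}) := by
    intro t₀ ht₀
    obtain ⟨U, hUo, ht₀U, A₀, hA₀m, hA₀0, hA₀top, hJ'⟩ := hJacLoc t₀ ht₀
    obtain ⟨U', hU'o, ht₀U', hfree⟩ :=
      exists_isOpen_wFree_nhds T hTa {x : Gqs L v | IsRegularElt (x.val : GL (Fin 3) (LocalRing L v))} hRT hW0 t₀ ht₀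
    refine ⟨U' ∩ U, hU'o.inter hUo, ⟨ht₀U', ht₀U⟩, ?_⟩
    ext B hB
    have hVm : MeasurableSet (B ∩ (U' ∩ U ∩ {t : ↥T | IsRegularElt (((t : Gqs L v)).val : GL (Fin 3) (LocalRing L v))})) :=
      hB.inter ((hU'o.inter hUo).measurableSet.inter hSm)
    have hVfree : ∀ n : Gqs L v, n ∉ T → ∀ t ∈ B ∩ (U' ∩ U ∩ {t : ↥T | IsRegularElt (((t : Gqs L v)).val : GL (Fin 3) (LocalRing L v))}),
        ∀ t' ∈ B ∩ (U' ∩ U ∩ {t : ↥T | IsRegularElt (((t : Gqs L v)).val : GL (Fin 3) (LocalRing L v))}), ((t' : ↥T) : Gqs L v) ≠ n * t * n⁻¹ :=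
      wFree_mono T (U := U' ∩ {t : ↥T | ((t : Gqs L v)) ∈ {x : Gqs L v | IsRegularElt (x.val : GL (Fin 3) (LocalRing L v))}})
        (fun t ht => ⟨ht.2.1.1, ht.2.2⟩) hfree
    rw [Measure.restrict_apply hB, Measure.restrict_apply hB, withDensity_apply _ hVm]
    exact htube A₀ hA₀m hA₀0 hA₀top _ hVm (fun t ht => ht.2.2) hVfree
      (hJ' _ hVm (fun t ht => ht.2.1.2) (fun t ht => ht.2.2) hVfree)
  have hident := restrict_eq_restrict_of_forall_nhds hnbhd
  -- §f assembly
  intro f hf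
  have hσS : σ = σ.restrict {t : ↥T | IsRegularElt (((t : Gqs L v)).val : GL (Fin 3) (LocalRing L v))} := by
    refine (Measure.restrict_eq_self_of_ae_mem ?_).symm
    rw [ae_iff]
    exact hσcar
  have hOm : Measurable fun t : ↥T => ∫⁻ q, f (Φ (q, t)) ∂(quotientMeasure T tm hTcl ν) :=
    Measurable.lintegral_prod_left' (μ := (quotientMeasure T tm hTcl ν)) (hf.comp hΦc.measurable)
  rw [hformula f hf, hσS, hident, restrict_withDensity hSm, lintegral_withDensity_eq_lintegral_mul _ hD.coe_nnreal_ennreal hOm]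
  rfl

/-! ## §2 The Bochner form -/

set_option maxHeartbeats 1600000 in
set_option synthInstance.maxHeartbeats 200000 in
-- instance-term unification on the CM local carrier, as above
include hγ₀ hΦ hns hD in
/-- **The Bochner ∕ ℂ-valued form under the LOCAL socket at `T = Z(γ₀)`**: for every `g : G → ℂ` that is `ν`-integrable on `G_T`, `(t, q) ↦ g(Φ(q, t))` is integrable for
`(D · tm|_{T^{reg}}) ⊗ μ₀` and **`∫_{t ∈ T^{reg}} D(t) • (∫_{G⧸T} g(Φ(q, t)) dμ₀) dtm = [N(T):T] • ∫_{G_T} g dν`** (★ p849733 §2 `integrable_and_integral_eq_smul_of_lintegral_radial` along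
the weighted radial identity, then `integral_withDensity_eq_integral_smul`; verbatim ★ p851645 with `M ↦ T`). [cite: Rogawski1990, §12.5 p. 182] [cite: HarishChandra1970, Lemma 42] -/
theorem integral_cartanSet_eq_of_tubeJacobian_local
    (hJacLoc : ∀ t₀ : ↥T, IsRegularElt (((t₀ : Gqs L v)).val : GL (Fin 3) (LocalRing L v)) →
      ∃ U : Set ↥T, IsOpen U ∧ t₀ ∈ U ∧
        ∃ A₀ : Set (Gqs L v ⧸ T), MeasurableSet A₀ ∧ (quotientMeasure T tm (isClosed_cartan hT) ν) A₀ ≠ 0 ∧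
          (quotientMeasure T tm (isClosed_cartan hT) ν) A₀ ≠ ∞ ∧
          ∀ V : Set ↥T, MeasurableSet V → V ⊆ U → (∀ t ∈ V, IsRegularElt (((t : Gqs L v)).val : GL (Fin 3) (LocalRing L v))) →
            (∀ n : Gqs L v, n ∉ T → ∀ t ∈ V, ∀ t' ∈ V, ((t' : ↥T) : Gqs L v) ≠ n * t * n⁻¹) →
              ν (Φ '' (A₀ ×ˢ V)) = (quotientMeasure T tm (isClosed_cartan hT) ν) A₀ * ∫⁻ t in V, (D t : ℝ≥0∞) ∂tm)
    (g : Gqs L v → ℂ) (hg : IntegrableOn g {x | ∃ g t : Gqs L v, t ∈ T ∧ IsRegularElt (t.val : GL (Fin 3) (LocalRing L v)) ∧ g * t * g⁻¹ = x} ν) :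
    Integrable (fun p : ↥T × (Gqs L v ⧸ T) => g (Φ (p.2, p.1)))
        (((tm.restrict {t : ↥T | IsRegularElt (((t : Gqs L v)).val : GL (Fin 3) (LocalRing L v))}).withDensity fun t => (D t : ℝ≥0∞)).prod
          (quotientMeasure T tm (isClosed_cartan hT) ν)) ∧
      ∫ t in {t : ↥T | IsRegularElt (((t : Gqs L v)).val : GL (Fin 3) (LocalRing L v))},
          (D t : ℝ) • ∫ q, g (Φ (q, t)) ∂(quotientMeasure T tm (isClosed_cartan hT) ν) ∂tm =
        ((T.subgroupOf (Subgroup.normalizer (T : Set (Gqs L v)))).index : ℝ) •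
          ∫ y in {x | ∃ g t : Gqs L v, t ∈ T ∧ IsRegularElt (t.val : GL (Fin 3) (LocalRing L v)) ∧ g * t * g⁻¹ = x}, g y ∂ν := by
  have hmain := lintegral_cartanSet_eq_of_tubeJacobian_local hγ₀ hT Φ hΦ hns ν tm D hD hJacLoc
  have hTcl := isClosed_cartan hT
  haveI := hTcl
  obtain ⟨w⟩ := (inferInstance : Nonempty (PlacesOver L v))
  have hSm : MeasurableSet {t : ↥T | IsRegularElt (((t : Gqs L v)).val : GL (Fin 3) (LocalRing L v))} :=
    ((isOpen_setOf_isRegularElt_cmDatum_local (L := L) (H := qsForm L) (v := v) w (hns w)).preimage continuous_subtype_val).measurableSet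
  haveI : SecondCountableTopology ↥T := TopologicalSpace.Subtype.secondCountableTopology _
  haveI : BorelSpace ((Gqs L v ⧸ T) × ↥T) := Prod.borelSpace
  haveI : SecondCountableTopology (Gqs L v ⧸ T) := (QuotientGroup.isQuotientMap_mk _).secondCountableTopology QuotientGroup.isOpenMap_coe
  haveI : LocallyCompactSpace (Gqs L v ⧸ T) := QuotientGroup.instLocallyCompactSpace _
  haveI : SigmaCompactSpace (Gqs L v ⧸ T) := sigmaCompactSpace_of_locallyCompact_secondCountable
  haveI : SigmaFinite (quotientMeasure T tm hTcl ν) := SigmaFinite.of_isFiniteMeasureOnCompacts _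
  haveI : LocallyCompactSpace ↥T := hTcl.isClosedEmbedding_subtypeVal.locallyCompactSpace
  haveI : SigmaCompactSpace ↥T := sigmaCompactSpace_of_locallyCompact_secondCountable
  haveI : SigmaFinite tm := SigmaFinite.of_isFiniteMeasureOnCompacts _
  haveI : SigmaFinite ((tm.restrict {t : ↥T | IsRegularElt (((t : Gqs L v)).val : GL (Fin 3) (LocalRing L v))}).withDensity fun t => (D t : ℝ≥0∞)) :=
    SigmaFinite.withDensity_of_ne_top (ae_of_all _ fun _ => ENNReal.coe_ne_top)
  have hΦm : Measurable Φ := (continuous_conjFamily_and_smul T Φ hΦ).1.measurable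
  have hDm' : Measurable fun t : ↥T => (D t : ℝ≥0∞) := hD.coe_nnreal_ennreal
  have hmain' : ∀ f : Gqs L v → ℝ≥0∞, Measurable f →
      ((T.subgroupOf (Subgroup.normalizer (T : Set (Gqs L v)))).index : ℝ≥0∞) *
          ∫⁻ y in {x | ∃ g t : Gqs L v, t ∈ T ∧ IsRegularElt (t.val : GL (Fin 3) (LocalRing L v)) ∧ g * t * g⁻¹ = x}, f y ∂ν =
        ∫⁻ t, ∫⁻ q, f (Φ (q, t)) ∂(quotientMeasure T tm hTcl ν)
          ∂((tm.restrict {t : ↥T | IsRegularElt (((t : Gqs L v)).val : GL (Fin 3) (LocalRing L v))}).withDensity fun t => (D t : ℝ≥0∞)) := by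
    intro f hf
    have hOm : Measurable fun t : ↥T => ∫⁻ q, f (Φ (q, t)) ∂(quotientMeasure T tm hTcl ν) :=
      Measurable.lintegral_prod_left' (μ := (quotientMeasure T tm hTcl ν)) (hf.comp hΦm)
    rw [hmain f hf, lintegral_withDensity_eq_lintegral_mul _ hDm' hOm]
    rfl
  obtain ⟨hint, heq⟩ := integrable_and_integral_eq_smul_of_lintegral_radial hΦm hmain' g hg
  refine ⟨hint, ?_⟩
  rw [← heq, integral_withDensity_eq_integral_smul hD]
  rfl

end CM

end Summit.HodgeConjecture.HodgeConjecture.Cruxes.H413.F0P3cStCharTSWeylCartanJacobian
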